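import Summits.QuantumFields.YangMills.Theorems.BalabanUVNodesN09TowerOfNumericsAlphaFree
import Summits.QuantumFields.YangMills.Theorems.BalabanUVNodesN09HierarchyBindersOfLevelwiseThm1

/-!
# BalabanUVNodes ∕ N09 — ROAD A′'s NUMERICS ARE RUN-FREE: at `d = 4`, `L = F.L` (`T4Family.P_d ∕ P_L`, `rfl`) the `α`-free doors' numeric hypotheses are NINE CLOSED-FORM
# inequalities in `(εreg, ε₂₉, ε₀; F.L, N)`, the SAME for every run `P` — hence a `∀ P` door from one numerics row

Cell `pub-ymgap` (YM-PLAN Track A), width seat `pub-ymgap-dag-n09-w4` g6 (FILE 3 = INTENT-3); count-neutral helper of K1⁹ `StabilityBRunRowsAtRecordR13SepCoPHV` =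
stmt-QuantumFields-27364 (`--supports`, `--as helper`).  [I] = [Balaban1987RG1] (CMP 109).

WHY.  The K1⁹ rung `NodesAtSomeRecord13PWS` asks `∀ P : B12.RunParams, Nodes (leavesP w P)` at ONE Stage-13 witness; FILE 2's `α`-free doors display N09's numerics through
`(F.P P.K).d` and `(F.P P.K).L`, i.e. seemingly per run.  But `(F.P K).d = 4` and `(F.P K).L = F.L` definitionally, so the numerics are ONE row per witness: §1 computes the
closed forms at `d = 4` — `hε3 : 36608·εreg ≤ 1∕3` · `hε2 : 64·L²·εreg ≤ δ_N` · `hn1 : 1640·(12·L·ε₂₉ + 18·εreg)·L⁶ ≤ 1` · `hn2 : 13·(12·L·ε₂₉ + 18·εreg)·L³ < δ_N` ·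
`hord : 2·εreg∕L² + 240·L⁴·ε₂₉ ≤ ε₀` (`max(ε₂₉, 60L⁴ε₂₉) = 60L⁴ε₂₉` for `L ≥ 1`, `ε₂₉ ≥ 0`) · `h24 : 9·L²·ε₀ < 1∕24` · `h64 : 576·L²·ε₀ < δ_N` · `hL : 1413·L⁵·ε₀ < 1` ·
`hnumF : 4·L²·ε₀ < δ_Fed` — and §2 re-runs FILE 2's two-radii door under `∀ P` from that single row.

WHAT IS PROVED (theorems only; 0 def, 0 instance, 0 notation, 0 sorry).  §1 `numericsP_of_closedForm` (the nine `(F.P K)`-level numeric hypotheses of the `α`-free doors from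
the nine closed forms, every `K`) · `prop2NumericsP_of_closedForm` · ★ `closedFormNumerics_inhabited` (A6: the nine closed forms are jointly inhabited for every `L`, `δ, δF > 0`) · §2 ★★★ `thm3Member_forall_runs_of_thm1_of_reg8_of_closedFormNumerics` (FILE 2's two-radii `α`-free door for EVERY run `P` from ONE
closed-form numerics row + the run-indexed non-numeric letters `hC hle hreg8 hcov hU hcrit h11 hres huniq`) · ★★★
`thm3Member_forall_runs_of_h11_of_hres_of_reg8_of_closedFormNumerics` (the same with `huniq` GONE — dag-n09-w1 g7's `huniq_of_h11` — at the price of the Prop-2 ∕ `ε₀` rows read at `εbg`).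

HONEST FRAMING.  Count-neutral BOOKKEEPING (`rfl` faces of `T4Family.P` + `norm_num`∕`ring` arithmetic) BY NAME; nothing of Bałaban's estimates asserted; no numerics row OF
RECORD is claimed to meet the closed forms (K0-numerics lane); `hreg` ∕ N09 NOT discharged; conjunct 1 (Lemma 4) ∕ FLAG №7 untouched; K0⁷ ∕ K1⁹ ∕ K3⁸ NOT closed; counts
unmoved (typed 28∕28 · discharged 5∕28); no summit statement is proved here; one finite four-torus programme at fixed `ε = L^{−K}` per run — R4 closes the conditional
rung `BalabanLadder.UV` only; NOT continuum ∕ ℝ⁴ ∕ infinite volume ∕ OS; the Yang–Mills mass gap (Clay) is NOT proved by any of this.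
-/

noncomputable section

namespace Summit.QuantumFields.YangMills.BalabanUVNodes.N09TowerOfNumericsRunFree

open MeasureTheory Set Function Filter Topology
open scoped ENNReal NNReal
open Literature.MathematicalPhysics.QuantumFieldTheory.Balaban1983to89
open Literature.MathematicalPhysics.QuantumFieldTheory.Balaban1983to89.T4Continuum (T4Family)
open Literature.MathematicalPhysics.QuantumFieldTheory.Balaban1983to89.Node00
open Literature.MathematicalPhysics.QuantumFieldTheory.Balaban1983to89.ExpMeanLog (deltaSU)
open Literature.MathematicalPhysics.QuantumFieldTheory.Balaban1983to89.FederbushMean (deltaFed)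
open Literature.MathematicalPhysics.QuantumFieldTheory.Balaban1983to89.DagBinding (WorldP leavesP)
open Literature.MathematicalPhysics.QuantumFieldTheory.Balaban1983to89.B12RTGaugeInvariance254 (liftTransf)
open Literature.MathematicalPhysics.QuantumFieldTheory.Balaban1983to89.GaugeField (gaugeAct)
open N09TowerOfNumericsAlphaFree (thm3Member_stage13SepCoPH_atDomAlt_of_thm1_of_reg8_of_numerics_alphaFree)
open N09HierarchyBindersOfLevelwiseThm1 (huniq_of_h11)

variable {F : T4Family} {N : ℕ}

/-! ## §1  The closed forms at `d = 4`, `L = F.L` give the `(F.P K)`-level numerics, every `K` -/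

/-- **THE NINE `(F.P K)`-LEVEL NUMERIC HYPOTHESES OF THE `α`-FREE DOORS FROM NINE CLOSED FORMS AT `d = 4`, `L = F.L`** (`T4Family.P_d`, `T4Family.P_L` are `rfl`; the rest is
`((4+2)L)²∕4 = 9L²`, `((4+4)L)² = 64L²`, `(4L)²∕4 = 4L²`, `L^{4−1} = L³`, `143·(8²∕4)² = 36608`, `max(ε₂₉, 60L⁴ε₂₉) = 60L⁴ε₂₉`).  Uniform in `K`: one numerics row serves every run.
[cite: Balaban1987RG1, (0.1) p.251, (0.19) p.255, (2.9)–(2.10) pp.266–267 (bookkeeping)] -/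
theorem numericsP_of_closedForm (F : T4Family) (K : ℕ) {εreg ε29 ε₀ δ δF : ℝ} (hε29 : 0 ≤ ε29)
    (c3 : 36608 * εreg ≤ 1 / 3) (c2 : 64 * (F.L : ℝ) ^ 2 * εreg ≤ δ)
    (cn1 : 1640 * (12 * (F.L : ℝ) * ε29 + 18 * εreg) * (F.L : ℝ) ^ 6 ≤ 1)
    (cn2 : 13 * (12 * (F.L : ℝ) * ε29 + 18 * εreg) * (F.L : ℝ) ^ 3 < δ)
    (cord : 2 * εreg / (F.L : ℝ) ^ 2 + 240 * (F.L : ℝ) ^ 4 * ε29 ≤ ε₀)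
    (c24 : 9 * (F.L : ℝ) ^ 2 * ε₀ < 1 / 24) (c64 : 576 * (F.L : ℝ) ^ 2 * ε₀ < δ) (cL : 1413 * (F.L : ℝ) ^ 5 * ε₀ < 1) (cF : 4 * (F.L : ℝ) ^ 2 * ε₀ < δF) :
    (143 * (((((F.P K).d + 4 : ℕ) : ℝ)) ^ 2 / 4) ^ 2) * εreg ≤ 1 / 3 ∧
    2 * εreg ≤ 2 * δ / ((((F.P K).d + 4) * (F.P K).L : ℕ) : ℝ) ^ 2 ∧
    1640 * (2 * (((((F.P K).d + 2) * (F.P K).L : ℕ) : ℝ) * ε29) +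
        ((((F.P K).d + 2) * (F.P K).L : ℕ) : ℝ) ^ 2 / 4 * (2 * εreg / ((F.P K).L : ℝ) ^ 2)) * (((F.P K).L : ℝ) ^ ((F.P K).d - 1)) ^ 2 ≤ 1 ∧
    13 * (2 * (((((F.P K).d + 2) * (F.P K).L : ℕ) : ℝ) * ε29) +
        ((((F.P K).d + 2) * (F.P K).L : ℕ) : ℝ) ^ 2 / 4 * (2 * εreg / ((F.P K).L : ℝ) ^ 2)) * ((F.P K).L : ℝ) ^ ((F.P K).d - 1) < δ ∧
    2 * εreg / ((F.P K).L : ℝ) ^ 2 + 4 * max ε29 (10 * (((((F.P K).d + 2) * (F.P K).L : ℕ) : ℝ) * ε29) * ((F.P K).L : ℝ) ^ ((F.P K).d - 1)) ≤ ε₀ ∧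
    ((((F.P K).d + 2) * (F.P K).L : ℕ) : ℝ) ^ 2 / 4 * ε₀ < 1 / 24 ∧
    64 * (((((F.P K).d + 2) * (F.P K).L : ℕ) : ℝ) ^ 2 / 4 * ε₀) < δ ∧
    157 * (((((F.P K).d + 2) * (F.P K).L : ℕ) : ℝ) ^ 2 / 4 * ε₀) < ((((F.P K).L : ℝ)) ^ ((F.P K).d - 1))⁻¹ ∧
    ((((F.P K).d * (F.P K).L : ℕ) : ℝ)) ^ 2 / 4 * ε₀ < δF := by
  have hL1 : (1 : ℝ) ≤ F.L := by exact_mod_cast F.hL.2.le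
  have hL0 : (0 : ℝ) < F.L := by linarith
  have hLne : (F.L : ℝ) ≠ 0 := hL0.ne'
  simp only [T4Family.P_d, T4Family.P_L]
  push_cast
  -- the recurring closed forms
  have e36608 : (143 : ℝ) * (8 ^ 2 / 4) ^ 2 = 36608 := by norm_num
  have e18 : (6 * (F.L : ℝ)) ^ 2 / 4 * (2 * εreg / (F.L : ℝ) ^ 2) = 18 * εreg := by
    field_simp
    ring
  have e9 : (6 * (F.L : ℝ)) ^ 2 / 4 = 9 * (F.L : ℝ) ^ 2 := by ring
  have hmax : max ε29 (10 * (6 * (F.L : ℝ) * ε29) * (F.L : ℝ) ^ 3) = 60 * (F.L : ℝ) ^ 4 * ε29 := by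
    rw [max_eq_right]
    · ring
    · have h1 : (1 : ℝ) ≤ 60 * (F.L : ℝ) ^ 4 := by nlinarith [one_le_pow₀ (M₀ := ℝ) (a := (F.L : ℝ)) (n := 4) hL1]
      nlinarith
  rw [e36608, e18, hmax, e9]
  refine ⟨c3, ?_, ?_, ?_, ?_, c24, ?_, ?_, ?_⟩
  · rw [le_div_iff₀ (by positivity)]
    have : 2 * εreg * (8 * (F.L : ℝ)) ^ 2 = 2 * (64 * (F.L : ℝ) ^ 2 * εreg) := by ring
    rw [this]; linarith
  · have : (1640 : ℝ) * (2 * (6 * (F.L : ℝ) * ε29) + 18 * εreg) * ((F.L : ℝ) ^ 3) ^ 2 = 1640 * (12 * (F.L : ℝ) * ε29 + 18 * εreg) * (F.L : ℝ) ^ 6 := by ring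
    rw [this]; exact cn1
  · have : (13 : ℝ) * (2 * (6 * (F.L : ℝ) * ε29) + 18 * εreg) * (F.L : ℝ) ^ 3 = 13 * (12 * (F.L : ℝ) * ε29 + 18 * εreg) * (F.L : ℝ) ^ 3 := by ring
    rw [this]; exact cn2
  · have : 4 * (60 * (F.L : ℝ) ^ 4 * ε29) = 240 * (F.L : ℝ) ^ 4 * ε29 := by ring
    rw [this]; exact cord
  · have : (64 : ℝ) * (9 * (F.L : ℝ) ^ 2 * ε₀) = 576 * (F.L : ℝ) ^ 2 * ε₀ := by ring
    rw [this]; exact c64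
  · have hΛ : (0 : ℝ) < (F.L : ℝ) ^ 3 := by positivity
    rw [← one_div, lt_div_iff₀ hΛ]
    have : (157 : ℝ) * (9 * (F.L : ℝ) ^ 2 * ε₀) * (F.L : ℝ) ^ 3 = 1413 * (F.L : ℝ) ^ 5 * ε₀ := by ring
    rw [this]; exact cL
  · have : (4 * (F.L : ℝ)) ^ 2 / 4 * ε₀ = 4 * (F.L : ℝ) ^ 2 * ε₀ := by ring
    rw [this]; exact cF

/-- The two [B7] Prop-2 rows ALONE at `F.P K` from their closed forms at ANY radius `ε` (used at `ε = εbg` for dag-n09-w1 g7's `huniq_of_h11`).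
[cite: Balaban1985Averaging, Prop. 2 (53) p.26; Balaban1987RG1, (0.1) p.251 (bookkeeping)] -/
theorem prop2NumericsP_of_closedForm (F : T4Family) (K : ℕ) {ε δ : ℝ} (c3 : 36608 * ε ≤ 1 / 3) (c2 : 64 * (F.L : ℝ) ^ 2 * ε ≤ δ) :
    (143 * (((((F.P K).d + 4 : ℕ) : ℝ)) ^ 2 / 4) ^ 2) * ε ≤ 1 / 3 ∧ 2 * ε ≤ 2 * δ / ((((F.P K).d + 4) * (F.P K).L : ℕ) : ℝ) ^ 2 := by
  have hL1 : (1 : ℝ) ≤ F.L := by exact_mod_cast F.hL.2.le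
  simp only [T4Family.P_d, T4Family.P_L]
  push_cast
  have e36608 : (143 : ℝ) * (8 ^ 2 / 4) ^ 2 = 36608 := by norm_num
  rw [e36608]
  refine ⟨c3, ?_⟩
  rw [le_div_iff₀ (by positivity)]
  have : 2 * ε * (8 * (F.L : ℝ)) ^ 2 = 2 * (64 * (F.L : ℝ) ^ 2 * ε) := by ring
  rw [this]; linarith

/-- A real function continuous at `0` with value `0 < C` there is `< C` for all small `t > 0` (FILE 1's device, restated privately to keep this file's imports lean).
[cite: Balaban1987RG1, (2.9) p.266 (bookkeeping)] -/
private theorem eventually_nhdsGT_lt {g : ℝ → ℝ} (hg : ContinuousAt g 0) (h0 : g 0 = 0) {C : ℝ} (hC : 0 < C) :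
    ∀ᶠ t in 𝓝[>] (0 : ℝ), g t < C :=
  nhdsWithin_le_nhds (hg.eventually_lt continuousAt_const (by rw [h0]; exact hC))

/-- ★ **A6 — THE NINE CLOSED FORMS ARE JOINTLY INHABITED** for every block size `L` and positive radii `δ` (read `δ_N`), `δF` (read `δ_Fed`): some `εreg, ε₂₉, ε₀ > 0` meet
them (choose `ε₀` small, then `εreg = ε₂₉ = t` small).  Pure real arithmetic; says NOTHING about the numerics OF RECORD. [cite: Balaban1987RG1, (0.19) p.255 and (2.9)–(2.10) pp.266–267 (bookkeeping)] -/
theorem closedFormNumerics_inhabited (L : ℕ) {δ δF : ℝ} (hδ : 0 < δ) (hδF : 0 < δF) :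
    ∃ εreg ε29 ε₀ : ℝ, 0 < εreg ∧ 0 < ε29 ∧ 0 < ε₀ ∧
      36608 * εreg ≤ 1 / 3 ∧ 64 * (L : ℝ) ^ 2 * εreg ≤ δ ∧
      1640 * (12 * (L : ℝ) * ε29 + 18 * εreg) * (L : ℝ) ^ 6 ≤ 1 ∧ 13 * (12 * (L : ℝ) * ε29 + 18 * εreg) * (L : ℝ) ^ 3 < δ ∧
      2 * εreg / (L : ℝ) ^ 2 + 240 * (L : ℝ) ^ 4 * ε29 ≤ ε₀ ∧
      9 * (L : ℝ) ^ 2 * ε₀ < 1 / 24 ∧ 576 * (L : ℝ) ^ 2 * ε₀ < δ ∧ 1413 * (L : ℝ) ^ 5 * ε₀ < 1 ∧ 4 * (L : ℝ) ^ 2 * ε₀ < δF := by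
  -- STEP 1: `ε₀ > 0` small
  obtain ⟨ε₀, hε₀, h24, h64, h1413, hF⟩ : ∃ ε₀ : ℝ, 0 < ε₀ ∧ 9 * (L : ℝ) ^ 2 * ε₀ < 1 / 24 ∧ 576 * (L : ℝ) ^ 2 * ε₀ < δ ∧
      1413 * (L : ℝ) ^ 5 * ε₀ < 1 ∧ 4 * (L : ℝ) ^ 2 * ε₀ < δF := by
    have h1 := eventually_nhdsGT_lt (g := fun e : ℝ => 9 * (L : ℝ) ^ 2 * e) (by fun_prop) (by simp) (C := 1 / 24) (by norm_num)
    have h2 := eventually_nhdsGT_lt (g := fun e : ℝ => 576 * (L : ℝ) ^ 2 * e) (by fun_prop) (by simp) hδ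
    have h3 := eventually_nhdsGT_lt (g := fun e : ℝ => 1413 * (L : ℝ) ^ 5 * e) (by fun_prop) (by simp) (C := 1) one_pos
    have h4 := eventually_nhdsGT_lt (g := fun e : ℝ => 4 * (L : ℝ) ^ 2 * e) (by fun_prop) (by simp) hδF
    have h0 : ∀ᶠ e in 𝓝[>] (0 : ℝ), 0 < e := eventually_mem_nhdsWithin
    obtain ⟨ε₀, hε₀⟩ := (h0.and (h1.and (h2.and (h3.and h4)))).exists
    exact ⟨ε₀, hε₀.1, hε₀.2.1, hε₀.2.2.1, hε₀.2.2.2.1, hε₀.2.2.2.2⟩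
  -- STEP 2: `εreg = ε₂₉ = t > 0` small
  have g1 := eventually_nhdsGT_lt (g := fun t : ℝ => 36608 * t) (by fun_prop) (by simp) (C := 1 / 3) (by norm_num)
  have g2 := eventually_nhdsGT_lt (g := fun t : ℝ => 64 * (L : ℝ) ^ 2 * t) (by fun_prop) (by simp) hδ
  have g3 := eventually_nhdsGT_lt (g := fun t : ℝ => 1640 * (12 * (L : ℝ) * t + 18 * t) * (L : ℝ) ^ 6) (by fun_prop) (by simp) (C := 1) one_pos
  have g4 := eventually_nhdsGT_lt (g := fun t : ℝ => 13 * (12 * (L : ℝ) * t + 18 * t) * (L : ℝ) ^ 3) (by fun_prop) (by simp) hδ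
  have g5 := eventually_nhdsGT_lt (g := fun t : ℝ => 2 * t / (L : ℝ) ^ 2 + 240 * (L : ℝ) ^ 4 * t) (by fun_prop) (by simp) hε₀
  have g0 : ∀ᶠ t in 𝓝[>] (0 : ℝ), 0 < t := eventually_mem_nhdsWithin
  obtain ⟨t, ht0, ht1, ht2, ht3, ht4, ht5⟩ := (g0.and (g1.and (g2.and (g3.and (g4.and g5))))).exists
  exact ⟨t, t, ε₀, ht0, ht0, hε₀, ht1.le, ht2.le, ht3.le, ht4, ht5.le, h24, h64, h1413, hF⟩

/-! ## §2  The two-radii `α`-free door for EVERY run from ONE closed-form numerics row -/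

section Door

variable [NeZero N] (θ : Stage13HParams F N) (h : θ.Provisos₁₃SepCoPH F N) {w : WorldP}

/-- ★★★ **N09's THEOREM-3 MEMBER AT THE STAGE-13 RECORD FOR EVERY RUN `P`, FROM ONE RUN-FREE NUMERICS ROW** — FILE 2's two-radii `α`-free door
`…N09TowerOfNumericsAlphaFree.thm3Member_stage13SepCoPH_atDomAlt_of_thm1_of_reg8_of_numerics_alphaFree` under `∀ P`, its nine run-indexed numeric hypotheses supplied by §1 from
the nine closed forms at `d = 4`, `L = F.L`: `36608·εreg ≤ 1∕3`, `64L²·εreg ≤ δ_N`, `1640(12Lε₂₉ + 18εreg)L⁶ ≤ 1`, `13(12Lε₂₉ + 18εreg)L³ < δ_N`, `2εreg∕L² + 240L⁴ε₂₉ ≤ ε₀`,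
`9L²ε₀ < 1∕24`, `576L²ε₀ < δ_N`, `1413L⁵ε₀ < 1`, `4L²ε₀ < δ_Fed` (+ `0 < εreg`, `0 < ε₂₉`, `0 ≤ ε₀`, `εreg ≤ εbg`, `hC`).  Run-indexed and DISPLAYED: [B11] Thm 1 (8)-membership
`hreg8`, (181)ˢᵒˡ `hcov`, (H-U) `hU`, N07's `hcrit`, [B11] ×3 at `εbg` (`h11 hres huniq`).  CONDITIONAL; nothing of Bałaban's estimates asserted; N09 NOT discharged.
[cite: Balaban1987RG1, Thm 3 p.264, p.259, (0.1) p.251, (0.4) p.253, (0.17)–(0.19) p.255, (2.9)–(2.10) pp.266–267; Balaban1985Variational, Thm 1 (8)–(10) p.279 and (181) p.307; Balaban1985Averaging, Prop. 2 (53) p.26 and Prop. 3 (124) p.36] -/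
theorem thm3Member_forall_runs_of_thm1_of_reg8_of_closedFormNumerics (hC : w.C = (datumOfRecord₁₃SepCoPH F N θ h).C)
    (hεreg : 0 < θ.toStage13Params.ν.εreg) (hε29 : 0 < θ.toStage13Params.ε₂₉) (hε₀ : 0 ≤ θ.toStage13Params.ν.ε₀) (hle : θ.toStage13Params.ν.εreg ≤ θ.εbg)
    (c3 : 36608 * θ.toStage13Params.ν.εreg ≤ 1 / 3) (c2 : 64 * (F.L : ℝ) ^ 2 * θ.toStage13Params.ν.εreg ≤ deltaSU (Fin N))
    (cn1 : 1640 * (12 * (F.L : ℝ) * θ.toStage13Params.ε₂₉ + 18 * θ.toStage13Params.ν.εreg) * (F.L : ℝ) ^ 6 ≤ 1)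
    (cn2 : 13 * (12 * (F.L : ℝ) * θ.toStage13Params.ε₂₉ + 18 * θ.toStage13Params.ν.εreg) * (F.L : ℝ) ^ 3 < deltaSU (Fin N))
    (cord : 2 * θ.toStage13Params.ν.εreg / (F.L : ℝ) ^ 2 + 240 * (F.L : ℝ) ^ 4 * θ.toStage13Params.ε₂₉ ≤ θ.toStage13Params.ν.ε₀)
    (c24 : 9 * (F.L : ℝ) ^ 2 * θ.toStage13Params.ν.ε₀ < 1 / 24) (c64 : 576 * (F.L : ℝ) ^ 2 * θ.toStage13Params.ν.ε₀ < deltaSU (Fin N))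
    (cL : 1413 * (F.L : ℝ) ^ 5 * θ.toStage13Params.ν.ε₀ < 1) (cF : 4 * (F.L : ℝ) ^ 2 * θ.toStage13Params.ν.ε₀ < deltaFed (Fin N)) :
    ∀ P : B12.RunParams,
      (∀ k, k ≤ P.K → ∀ V ∈ domAltOfRecord F N θ.ν P.K k, Uk F N P.K k θ.εbg V ∈ bgReg F N P.K k θ.toStage13Params.ν.εreg) →
      (∀ j < P.K, ∀ (v : GaugeTransf (F.P P.K) (j + 1) (SU N)) (W : GaugeField (F.P P.K) (j + 1) (SU N)),
        UkExists F N P.K (j + 1) θ.toStage13Params.ν.εreg W →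
          critCfgOfRecord F N θ.toStage13Params.ν P.K j (gaugeAct v W) = gaugeAct (liftTransf v) (critCfgOfRecord F N θ.toStage13Params.ν P.K j W)) →
      (∀ k, Measurable (Uk F N P.K (k + 1) θ.toStage13Params.ν.εreg)) →
      (∀ j < P.K, ContinuousOn (critCfgOfRecord F N θ.toStage13Params.ν P.K j) (domAltOfRecord F N θ.ν P.K (j + 1))) →
      (∀ k, k ≤ P.K → ∀ V ∈ domAltOfRecord F N θ.ν P.K k, UkExists F N P.K k θ.εbg V ∧ UniqueUkOrbit F N P.K k θ.εbg V) →
      (∀ k, k ≤ P.K → HRestrict F N θ.εbg P.K k (domAltOfRecord F N θ.ν P.K k)) →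
      (∀ k, k ≤ P.K → ∀ V ∈ domAltOfRecord F N θ.ν P.K k, ∀ j < k,
        UniqueUkOrbit F N P.K (j + 1) θ.εbg (Averaging.iter (avOfRecord F N P.K) (j + 1) (Uk F N P.K k θ.εbg V))) →
      ((leavesP w P).smallCouplings → (leavesP w P).smallFieldInductive) := by
  intro P hreg8 hcov hU hcrit h11 hres huniq
  obtain ⟨hε3, hε2, hn1, hn2, hord, h24, h64, hL, hnumF⟩ :=
    numericsP_of_closedForm F P.K (δ := deltaSU (Fin N)) (δF := deltaFed (Fin N)) hε29.le c3 c2 cn1 cn2 cord c24 c64 cL cF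
  exact thm3Member_stage13SepCoPH_atDomAlt_of_thm1_of_reg8_of_numerics_alphaFree θ h P hC hreg8 hle hεreg hε3 hε2 hε29 hn1 hn2 hord hε₀ h24 h64 hL hnumF
    hcov hU hcrit h11 hres huniq

/-- ★★★ **THE SAME DOOR WITH `huniq` GONE** — dag-n09-w1 g7's `…N09HierarchyBindersOfLevelwiseThm1.huniq_of_h11` (p640069: uniqueness along the hierarchy ⇐ the level-wise `h11` +
[B7] (53) nesting) supplies `huniq` from `h11` and the Prop-2 ∕ `ε₀` rows AT THE RADIUS `εbg`: closed forms `36608·εbg ≤ 1∕3`, `64L²·εbg ≤ δ_N`, `2·εbg ≤ ε₀·L²`; since `εreg ≤ εbg`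
the two `εreg`-rows of §2 follow and are dropped.  Run-indexed and DISPLAYED: `hreg8 hcov hU hcrit h11 hres` — [B11] appears as the level-wise `h11`, the (8)-membership `hreg8` and the
restriction property `hres` only.  CONDITIONAL; nothing of Bałaban's estimates asserted; N09 NOT discharged.
[cite: Balaban1987RG1, Thm 3 p.264, p.259, (1.1)–(1.2) p.260, (0.4) p.253, (2.9)–(2.10) pp.266–267; Balaban1985Variational, Thm 1 (8)–(10) p.279 and (181) p.307; Balaban1985Averaging, Prop. 2 (53) p.26 and Prop. 3 (124) p.36] -/
theorem thm3Member_forall_runs_of_h11_of_hres_of_reg8_of_closedFormNumerics (hC : w.C = (datumOfRecord₁₃SepCoPH F N θ h).C)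
    (hεreg : 0 < θ.toStage13Params.ν.εreg) (hε29 : 0 < θ.toStage13Params.ε₂₉) (hε₀ : 0 ≤ θ.toStage13Params.ν.ε₀) (hle : θ.toStage13Params.ν.εreg ≤ θ.εbg)
    (c3b : 36608 * θ.εbg ≤ 1 / 3) (c2b : 64 * (F.L : ℝ) ^ 2 * θ.εbg ≤ deltaSU (Fin N)) (c0b : 2 * θ.εbg ≤ θ.toStage13Params.ν.ε₀ * (F.L : ℝ) ^ 2)
    (cn1 : 1640 * (12 * (F.L : ℝ) * θ.toStage13Params.ε₂₉ + 18 * θ.toStage13Params.ν.εreg) * (F.L : ℝ) ^ 6 ≤ 1)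
    (cn2 : 13 * (12 * (F.L : ℝ) * θ.toStage13Params.ε₂₉ + 18 * θ.toStage13Params.ν.εreg) * (F.L : ℝ) ^ 3 < deltaSU (Fin N))
    (cord : 2 * θ.toStage13Params.ν.εreg / (F.L : ℝ) ^ 2 + 240 * (F.L : ℝ) ^ 4 * θ.toStage13Params.ε₂₉ ≤ θ.toStage13Params.ν.ε₀)
    (c24 : 9 * (F.L : ℝ) ^ 2 * θ.toStage13Params.ν.ε₀ < 1 / 24) (c64 : 576 * (F.L : ℝ) ^ 2 * θ.toStage13Params.ν.ε₀ < deltaSU (Fin N))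
    (cL : 1413 * (F.L : ℝ) ^ 5 * θ.toStage13Params.ν.ε₀ < 1) (cF : 4 * (F.L : ℝ) ^ 2 * θ.toStage13Params.ν.ε₀ < deltaFed (Fin N)) :
    ∀ P : B12.RunParams,
      (∀ k, k ≤ P.K → ∀ V ∈ domAltOfRecord F N θ.ν P.K k, Uk F N P.K k θ.εbg V ∈ bgReg F N P.K k θ.toStage13Params.ν.εreg) →
      (∀ j < P.K, ∀ (v : GaugeTransf (F.P P.K) (j + 1) (SU N)) (W : GaugeField (F.P P.K) (j + 1) (SU N)),
        UkExists F N P.K (j + 1) θ.toStage13Params.ν.εreg W →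
          critCfgOfRecord F N θ.toStage13Params.ν P.K j (gaugeAct v W) = gaugeAct (liftTransf v) (critCfgOfRecord F N θ.toStage13Params.ν P.K j W)) →
      (∀ k, Measurable (Uk F N P.K (k + 1) θ.toStage13Params.ν.εreg)) →
      (∀ j < P.K, ContinuousOn (critCfgOfRecord F N θ.toStage13Params.ν P.K j) (domAltOfRecord F N θ.ν P.K (j + 1))) →
      (∀ k, k ≤ P.K → ∀ V ∈ domAltOfRecord F N θ.ν P.K k, UkExists F N P.K k θ.εbg V ∧ UniqueUkOrbit F N P.K k θ.εbg V) →
      (∀ k, k ≤ P.K → HRestrict F N θ.εbg P.K k (domAltOfRecord F N θ.ν P.K k)) →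
      ((leavesP w P).smallCouplings → (leavesP w P).smallFieldInductive) := by
  intro P hreg8 hcov hU hcrit h11 hres
  have hεbg : 0 < θ.εbg := hεreg.trans_le hle
  have c3 : 36608 * θ.toStage13Params.ν.εreg ≤ 1 / 3 := (mul_le_mul_of_nonneg_left hle (by norm_num)).trans c3b
  have c2 : 64 * (F.L : ℝ) ^ 2 * θ.toStage13Params.ν.εreg ≤ deltaSU (Fin N) := (mul_le_mul_of_nonneg_left hle (by positivity)).trans c2b
  obtain ⟨hε3b, hε2b⟩ := prop2NumericsP_of_closedForm F P.K (δ := deltaSU (Fin N)) c3b c2b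
  have hε₀b : 2 * θ.εbg ≤ θ.toStage13Params.ν.ε₀ * (((F.P P.K).L : ℝ)) ^ 2 := by simpa only [T4Family.P_L] using c0b
  exact thm3Member_forall_runs_of_thm1_of_reg8_of_closedFormNumerics θ h hC hεreg hε29 hε₀ hle c3 c2 cn1 cn2 cord c24 c64 cL cF P hreg8 hcov hU hcrit h11 hres
    (huniq_of_h11 (F := F) (N := N) θ.toStage13Params.ν hεbg hε3b hε2b hε₀b h11)

end Door

end Summit.QuantumFields.YangMills.BalabanUVNodes.N09TowerOfNumericsRunFree

end
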